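import Mathlib.Analysis.InnerProductSpace.PiL2
import Mathlib.Analysis.InnerProductSpace.Calculus
import Mathlib.Analysis.Calculus.ContDiff.Operations
import Mathlib.Analysis.Calculus.FDeriv.Analytic
import Mathlib.Analysis.Normed.Module.FiniteDimension
import Mathlib.Analysis.Normed.Module.Ball.Pointwise
import Mathlib.Topology.UniformSpace.HeineCantor
import Mathlib.Topology.MetricSpace.Thickening
import HarnessLib

/-!
# Normal projections of an immersed disc and a global normal frame by discrete transport

Topic `Literature/Topology/FourManifolds`; infrastructure for the named fact
`Literature.Topology.FourManifolds.Knot.IsSliceDisc.exists_conicalTube_hasFraming_zero`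
(`SliceDiscEndCollarFacts.lean`: the framed conical tube of a conical slice disc; Kosinski,
*Differential Manifolds* (1993), Ch. III (4.1)–(4.2)), whose remaining input after
`SliceDiscConicalTube.lean` is a *transversal framing of the disc*, i.e. a trivialisation of the normal
bundle of an immersed `2`-disc in `ℝ⁴`. The normal bundle of a disc is trivial because the disc is
contractible (Hirsch, *Differential Topology* (1976), Ch. 4 §2, Cor. 2.5: *"every vector bundle over a
contractible paracompact space is trivial"*); this file makes that explicit and smooth for an immersion
`g : ℝ² → F` into a real inner product space, on a closed ball, by **transport along the rays from the
centre in finitely many projection steps** — the proof of the covering homotopy theorem (Hirsch, Ch. 4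
§1, Thm. 1.5) specialised to the radial contraction, with the orthogonal projections onto the normal
spaces as local trivialisations. Everything here is proved; no named facts are introduced.

* § Normal projection. For `L : ℝᵐ →L F` (meant: `L = Dg(x)`, injective) the formal adjoint
  `clmAdj L`, the Gram operator `clmGram L = Lᵀ L` (invertible for injective `L`), the tangential
  projection `tangProj L = L (LᵀL)⁻¹ Lᵀ` and the **normal projection** `normProj L = 1 - tangProj L`
  onto `(range L)ᗮ`; they are `C^∞` functions of `L` on the open set of injective maps (smoothness of
  operator inversion, `ContinuousLinearMap.IsInvertible.contDiffAt_map_inverse`), `normProj L` kills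
  `range L`, fixes exactly the vectors orthogonal to `range L`, and is idempotent.
* § Transversality. For `m = 2`: a pair `n₀, n₁` is transversal to `L`
  (`L v + ∑ aᵢ nᵢ = 0 ⇒ v = 0 ∧ a = 0`, the form used by `ConicalFraming.transversal`) iff the normal
  projections `normProj L nᵢ` are linearly independent, iff the four vectors `L e₀, L e₁, n₀, n₁` are
  linearly independent (`transversal_iff_linearIndependent_normProj`, `…_four`); the latter is an open
  condition (Mathlib's `isOpen_setOf_linearIndependent`).
* § Transport. The **step lemma** `linearIndependent_map_of_opNorm_sub_lt`: if `‖P - Q‖ < 1` then `P`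
  maps linearly independent vectors fixed by `Q` to linearly independent vectors. Hence, for a `C^∞`
  map `g : ℝ² → F` (`F` finite-dimensional) with injective differential on the closed ball `B̄(0, R)`,
  transporting a basis of the normal space at `0` along `t ↦ t z` through the normal projections at the
  points `(k/N) z`, `k = 1, …, N` (`N` large, by uniform continuity of `x ↦ normProj (Dg(x))` on a
  compact ball), gives **a `C^∞` frame `n₀, n₁` of the normal bundle** on a larger open ball:
  `normProj (Dg x) (nᵢ x) = nᵢ x` and `n₀ x, n₁ x` linearly independent (`exists_normalFrame`).

## References

* M. W. Hirsch, *Differential Topology*, GTM 33 (1976), Ch. 4 §1 Thm. 1.5 (covering homotopy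
  theorem), §2 Cor. 2.5 (bundles over contractible spaces are trivial). [cite: Hirsch1976, Ch. 4 §2 Cor. 2.5]
* A. A. Kosinski, *Differential Manifolds* (1993), Ch. III (4.1)–(4.2). [cite: Kosinski1993, Ch. III Thm (4.2)]

## Design notes

* The adjoint is written in the standard basis of `ℝᵐ` (`innerSL`), as in `TwoKnotNormalTube.lean`,
  so that its smoothness in `L` is that of a continuous linear expression; `ContinuousLinearMap.inverse`
  is the junk-free inverse (`0` off the invertible operators).
* No instances, no notation beyond the local `𝔼 n`; no `sorry`.
-/

noncomputable section

open Set Metric Function Filter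
open scoped ContDiff Topology RealInnerProductSpace

namespace Literature.Topology.FourManifolds

/-- Local notation: `𝔼 n` is the model Euclidean space `EuclideanSpace ℝ (Fin n)`. -/
local notation "𝔼 " n:arg => EuclideanSpace ℝ (Fin n)

section NormalProjection

variable {F : Type*} [NormedAddCommGroup F] [InnerProductSpace ℝ F] {m : ℕ}

/-! ### The formal adjoint, the Gram operator and the two projections -/

/-- The **formal adjoint** `Lᵀ : F →L ℝᵐ` of `L : ℝᵐ →L F`, in the standard basis:
`Lᵀ z = ∑ᵢ ⟪L eᵢ, z⟫ eᵢ`. [folklore] -/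
def clmAdj (L : 𝔼 m →L[ℝ] F) : F →L[ℝ] 𝔼 m :=
  ∑ i : Fin m, (innerSL ℝ (L (EuclideanSpace.single i 1))).smulRight (EuclideanSpace.single i (1 : ℝ))

/-- Unfolding of the formal adjoint. [folklore] -/
theorem clmAdj_apply (L : 𝔼 m →L[ℝ] F) (z : F) :
    clmAdj L z = ∑ i : Fin m, ⟪L (EuclideanSpace.single i 1), z⟫ • EuclideanSpace.single i (1 : ℝ) := by
  simp [clmAdj]

/-- **Adjointness**: `⟪Lᵀ z, a⟫ = ⟪z, L a⟫`. [folklore] -/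
theorem inner_clmAdj (L : 𝔼 m →L[ℝ] F) (z : F) (a : 𝔼 m) : ⟪clmAdj L z, a⟫ = ⟪z, L a⟫ := by
  rw [clmAdj_apply, sum_inner]
  conv_rhs => rw [← (EuclideanSpace.basisFun (Fin m) ℝ).sum_repr a]
  simp only [EuclideanSpace.basisFun_repr, EuclideanSpace.basisFun_apply, map_sum, map_smul,
    inner_sum, inner_smul_right, inner_smul_left, EuclideanSpace.inner_single_left, map_one,
    one_mul, RCLike.conj_to_real]
  refine Finset.sum_congr rfl fun i _ ↦ ?_
  rw [real_inner_comm z]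
  ring

/-- `⟪a, Lᵀ z⟫ = ⟪L a, z⟫`. [folklore] -/
theorem inner_clmAdj' (L : 𝔼 m →L[ℝ] F) (a : 𝔼 m) (z : F) : ⟪a, clmAdj L z⟫ = ⟪L a, z⟫ := by
  rw [real_inner_comm, inner_clmAdj, real_inner_comm]

/-- The **Gram operator** `Lᵀ L : ℝᵐ →L ℝᵐ`. [folklore] -/
def clmGram (L : 𝔼 m →L[ℝ] F) : 𝔼 m →L[ℝ] 𝔼 m := (clmAdj L).comp L

/-- `⟪Lᵀ L a, b⟫ = ⟪L a, L b⟫`. [folklore] -/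
theorem inner_clmGram (L : 𝔼 m →L[ℝ] F) (a b : 𝔼 m) : ⟪clmGram L a, b⟫ = ⟪L a, L b⟫ := by
  rw [clmGram, ContinuousLinearMap.comp_apply, inner_clmAdj]

/-- **The Gram operator of an injective map is invertible.** [folklore] -/
theorem isInvertible_clmGram {L : 𝔼 m →L[ℝ] F} (hL : Injective L) : (clmGram L).IsInvertible := by
  have hinj : Injective (clmGram L) := by
    refine (injective_iff_map_eq_zero _).2 fun u hu ↦ ?_
    have h : ⟪L u, L u⟫ = 0 := by rw [← inner_clmGram, hu, inner_zero_left]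
    exact (injective_iff_map_eq_zero _).1 hL u (inner_self_eq_zero.1 h)
  let e : 𝔼 m ≃L[ℝ] 𝔼 m := (LinearEquiv.ofInjectiveEndo (clmGram L).toLinearMap hinj).toContinuousLinearEquiv
  exact ⟨e, by ext1 u; rfl⟩

/-- The **tangential projection** `L (LᵀL)⁻¹ Lᵀ` (orthogonal projection onto `range L` for
injective `L`). [folklore] -/
def tangProj (L : 𝔼 m →L[ℝ] F) : F →L[ℝ] F :=
  L.comp ((ContinuousLinearMap.inverse (clmGram L)).comp (clmAdj L))

/-- Unfolding of the tangential projection. [folklore] -/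
theorem tangProj_apply (L : 𝔼 m →L[ℝ] F) (z : F) :
    tangProj L z = L ((clmGram L).inverse (clmAdj L z)) := rfl

/-- The **normal projection** `1 - L (LᵀL)⁻¹ Lᵀ` (orthogonal projection onto `(range L)ᗮ` for
injective `L`). [folklore] -/
def normProj (L : 𝔼 m →L[ℝ] F) : F →L[ℝ] F := ContinuousLinearMap.id ℝ F - tangProj L

/-- Unfolding of the normal projection. [folklore] -/
theorem normProj_apply (L : 𝔼 m →L[ℝ] F) (z : F) : normProj L z = z - tangProj L z := rfl

/-! ### Smoothness in `L` -/

/-- The formal adjoint is a `C^∞` (indeed continuous linear) function of `L`. [folklore] -/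
theorem contDiff_clmAdj : ContDiff ℝ ∞ (clmAdj : (𝔼 m →L[ℝ] F) → (F →L[ℝ] 𝔼 m)) := by
  unfold clmAdj
  refine ContDiff.sum fun i _ ↦ ?_
  exact ((innerSL ℝ (E := F)).contDiff.comp (contDiff_id.clm_apply contDiff_const)).smulRight
    contDiff_const

/-- The Gram operator is a `C^∞` function of `L`. [folklore] -/
theorem contDiff_clmGram : ContDiff ℝ ∞ (clmGram : (𝔼 m →L[ℝ] F) → (𝔼 m →L[ℝ] 𝔼 m)) :=
  contDiff_clmAdj.clm_comp contDiff_id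

/-- **The tangential projection is `C^∞` in `L` at every injective `L`** (operator inversion is
smooth on the invertible operators). [folklore] -/
theorem contDiffAt_tangProj {L : 𝔼 m →L[ℝ] F} (hL : Injective L) :
    ContDiffAt ℝ ∞ (tangProj : (𝔼 m →L[ℝ] F) → (F →L[ℝ] F)) L :=
  contDiffAt_id.clm_comp (((isInvertible_clmGram hL).contDiffAt_map_inverse.comp L
    contDiff_clmGram.contDiffAt).clm_comp contDiff_clmAdj.contDiffAt)

/-- **The normal projection is `C^∞` in `L` at every injective `L`.** [folklore] -/
theorem contDiffAt_normProj {L : 𝔼 m →L[ℝ] F} (hL : Injective L) :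
    ContDiffAt ℝ ∞ (normProj : (𝔼 m →L[ℝ] F) → (F →L[ℝ] F)) L :=
  contDiffAt_const.sub (contDiffAt_tangProj hL)

/-! ### Algebra of the projections at an injective `L` -/

section Algebra

variable {L : 𝔼 m →L[ℝ] F} (hL : Injective L)
include hL

/-- `(LᵀL) (LᵀL)⁻¹ = 1`. [folklore] -/
theorem clmGram_inverse_apply (v : 𝔼 m) : clmGram L ((clmGram L).inverse v) = v :=
  (isInvertible_clmGram hL).self_apply_inverse v

/-- `(LᵀL)⁻¹ (LᵀL) = 1`. [folklore] -/
theorem inverse_clmGram_apply (u : 𝔼 m) : (clmGram L).inverse (clmGram L u) = u :=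
  (isInvertible_clmGram hL).inverse_apply_self u

/-- **The tangential projection fixes `range L`.** [folklore] -/
theorem tangProj_apply_map (a : 𝔼 m) : tangProj L (L a) = L a := by
  rw [tangProj_apply, ← ContinuousLinearMap.comp_apply (clmAdj L), ← clmGram,
    inverse_clmGram_apply hL]

/-- **The normal projection kills `range L`.** [folklore] -/
@[simp] theorem normProj_apply_map (a : 𝔼 m) : normProj L (L a) = 0 := by
  rw [normProj_apply, tangProj_apply_map hL, sub_self]

/-- `Lᵀ ∘ tangProj = Lᵀ`. [folklore] -/
theorem clmAdj_tangProj (z : F) : clmAdj L (tangProj L z) = clmAdj L z := by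
  rw [tangProj_apply, ← ContinuousLinearMap.comp_apply (clmAdj L), ← clmGram,
    clmGram_inverse_apply hL]

/-- `Lᵀ ∘ normProj = 0`: the normal projection lands in `(range L)ᗮ`. [folklore] -/
@[simp] theorem clmAdj_normProj (z : F) : clmAdj L (normProj L z) = 0 := by
  rw [normProj_apply, map_sub, clmAdj_tangProj hL, sub_self]

/-- The normal projection is orthogonal to `range L`: `⟪L a, normProj z⟫ = 0`. [folklore] -/
theorem inner_map_normProj (a : 𝔼 m) (z : F) : ⟪L a, normProj L z⟫ = 0 := by
  rw [← inner_clmAdj', clmAdj_normProj hL, inner_zero_right]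

/-- **The normal projection fixes exactly the vectors orthogonal to `range L`.** [folklore] -/
theorem normProj_eq_self_iff (z : F) : normProj L z = z ↔ ∀ a : 𝔼 m, ⟪L a, z⟫ = 0 := by
  constructor
  · intro h a
    rw [← h]
    exact inner_map_normProj hL a z
  · intro h
    have h0 : clmAdj L z = 0 := by
      apply ext_inner_right ℝ
      intro a
      rw [inner_clmAdj, inner_zero_left, real_inner_comm, h a]
    rw [normProj_apply, tangProj_apply, h0, map_zero, map_zero, sub_zero]

/-- **The normal projection is idempotent.** [folklore] -/
theorem normProj_normProj (z : F) : normProj L (normProj L z) = normProj L z :=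
  (normProj_eq_self_iff hL _).2 fun a ↦ inner_map_normProj hL a z

/-- **The kernel of the normal projection is `range L`.** [folklore] -/
theorem normProj_eq_zero_iff (z : F) : normProj L z = 0 ↔ z ∈ LinearMap.range (L : 𝔼 m →ₗ[ℝ] F) := by
  constructor
  · intro h
    rw [normProj_apply, sub_eq_zero] at h
    refine ⟨(clmGram L).inverse (clmAdj L z), ?_⟩
    rw [ContinuousLinearMap.coe_coe, ← tangProj_apply]
    exact h.symm
  · rintro ⟨a, rfl⟩
    exact normProj_apply_map hL a

end Algebra

/-! ### Transversality of a pair of vectors to `L` (`m = 2`) -/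

section Transversal

variable {L : 𝔼 2 →L[ℝ] F}

/-- Decomposition of a vector of `ℝ²` in the standard basis (the tree's `euclideanSpace_two_decomp`
of `DehnSurgeryTubularNbhdProofs.lean`, restated privately to keep this file's imports to Mathlib).
[folklore] -/
private theorem euclideanSpace_two_eq (v : 𝔼 2) :
    v = v 0 • EuclideanSpace.single 0 (1 : ℝ) + v 1 • EuclideanSpace.single 1 (1 : ℝ) := by
  ext i
  fin_cases i <;> simp

/-- **Transversality is linear independence of the normal projections.** For injective `L`, a pair
`n₀, n₁` satisfies `L v + ∑ aᵢ nᵢ = 0 ⇒ v = 0 ∧ a = 0` iff `normProj L n₀, normProj L n₁` are linearly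
independent. [folklore] -/
theorem transversal_iff_linearIndependent_normProj (hL : Injective L) (n : Fin 2 → F) :
    (∀ (v a : 𝔼 2), L v + ∑ i, a i • n i = 0 → v = 0 ∧ a = 0) ↔
      LinearIndependent ℝ (fun i ↦ normProj L (n i)) := by
  rw [Fintype.linearIndependent_iff]
  constructor
  · intro h c hc
    -- `∑ cᵢ nᵢ` has vanishing normal projection, hence lies in `range L`
    have h1 : normProj L (∑ i, c i • n i) = 0 := by
      rw [map_sum]
      simpa only [map_smul] using hc
    obtain ⟨v, hv⟩ := (normProj_eq_zero_iff hL _).1 h1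
    have h2 := h (-v) (WithLp.toLp 2 c) (by
      rw [map_neg, ← hv, neg_add_eq_zero]
      rfl)
    intro i
    have := congrArg (fun a : 𝔼 2 ↦ a i) h2.2
    simpa using this
  · intro h v a hva
    have h1 : ∑ i, a i • normProj L (n i) = 0 := by
      have := congrArg (normProj L) hva
      rwa [map_add, normProj_apply_map hL, zero_add, map_sum, map_zero,
        Finset.sum_congr rfl fun i _ ↦ map_smul _ _ _] at this
    have ha : ∀ i, a i = 0 := h (fun i ↦ a i) h1
    have ha0 : a = 0 := by
      ext i
      simpa using ha i
    refine ⟨?_, ha0⟩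
    rw [ha0] at hva
    simp only [PiLp.zero_apply, zero_smul, Finset.sum_const_zero, add_zero] at hva
    exact (injective_iff_map_eq_zero _).1 hL v hva

/-- **Transversality is linear independence of the four vectors `L e₀, L e₁, n₀, n₁`.** [folklore] -/
theorem transversal_iff_linearIndependent_four (n : Fin 2 → F) :
    (∀ (v a : 𝔼 2), L v + ∑ i, a i • n i = 0 → v = 0 ∧ a = 0) ↔
      LinearIndependent ℝ ![L (EuclideanSpace.single 0 1), L (EuclideanSpace.single 1 1), n 0, n 1] := by
  rw [Fintype.linearIndependent_iff]
  constructor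
  · intro h c hc
    rw [Fin.sum_univ_four] at hc
    simp only [Matrix.cons_val_zero, Matrix.cons_val_one, Matrix.cons_val] at hc
    have h2 := h (!₂[c 0, c 1]) (!₂[c 2, c 3]) (by
      rw [euclideanSpace_two_eq (!₂[c 0, c 1]), map_add, map_smul, map_smul, Fin.sum_univ_two]
      simpa [add_assoc] using hc)
    have e0 := congrArg (fun a : 𝔼 2 ↦ a 0) h2.1
    have e1 := congrArg (fun a : 𝔼 2 ↦ a 1) h2.1
    have e2 := congrArg (fun a : 𝔼 2 ↦ a 0) h2.2
    have e3 := congrArg (fun a : 𝔼 2 ↦ a 1) h2.2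
    simp only [PiLp.zero_apply] at e0 e1 e2 e3
    intro i
    fin_cases i
    · simpa using e0
    · simpa using e1
    · simpa using e2
    · simpa using e3
  · intro h v a hva
    have key := h ![v 0, v 1, a 0, a 1] (by
      rw [Fin.sum_univ_four]
      simp only [Matrix.cons_val_zero, Matrix.cons_val_one, Matrix.cons_val]
      rw [euclideanSpace_two_eq v, map_add, map_smul, map_smul, Fin.sum_univ_two] at hva
      simpa [add_assoc] using hva)
    have k0 : v 0 = 0 := by simpa using key 0
    have k1 : v 1 = 0 := by simpa using key 1
    have k2 : a 0 = 0 := by simpa using key 2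
    have k3 : a 1 = 0 := by simpa using key 3
    constructor
    · ext i; fin_cases i <;> simp [k0, k1]
    · ext i; fin_cases i <;> simp [k2, k3]

/-- Four linearly independent vectors `L e₀, L e₁, n₀, n₁` force `L` injective. [folklore] -/
theorem injective_of_linearIndependent_four {n : Fin 2 → F}
    (h : LinearIndependent ℝ ![L (EuclideanSpace.single 0 1), L (EuclideanSpace.single 1 1), n 0, n 1]) :
    Injective L := by
  refine (injective_iff_map_eq_zero _).2 fun v hv ↦ ?_
  exact (((transversal_iff_linearIndependent_four n).2 h) v 0 (by simpa using hv)).1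

end Transversal

end NormalProjection

/-! ### The step lemma of the transport -/

section Step

variable {E : Type*} [NormedAddCommGroup E] [NormedSpace ℝ E]

/-- **Step lemma.** If `‖P - Q‖ < 1`, then `P` maps any linearly independent family of vectors fixed
by `Q` to a linearly independent family: a vector `w` of their span with `P w = 0` satisfies
`w = Q w - P w`, `‖w‖ ≤ ‖Q - P‖ ‖w‖`, so `w = 0`. (With `P`, `Q` the normal projections at two nearby
points: the normal spaces are graphs over each other.) [folklore] -/
theorem linearIndependent_map_of_opNorm_sub_lt {P Q : E →L[ℝ] E} (h : ‖P - Q‖ < 1) {ι : Type*}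
    [Fintype ι] {v : ι → E} (hQ : ∀ i, Q (v i) = v i) (hv : LinearIndependent ℝ v) :
    LinearIndependent ℝ (fun i ↦ P (v i)) := by
  rw [Fintype.linearIndependent_iff] at hv ⊢
  intro c hc
  set w : E := ∑ i, c i • v i with hw
  have hQw : Q w = w := by
    rw [hw, map_sum]
    exact Finset.sum_congr rfl fun i _ ↦ by rw [map_smul, hQ i]
  have hPw : P w = 0 := by
    rw [hw, map_sum]
    simpa only [map_smul] using hc
  have hw0 : w = 0 := by
    by_contra hne
    have hpos : 0 < ‖w‖ := norm_pos_iff.2 hne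
    have h1 : w = (Q - P) w := by
      rw [show (Q - P) w = Q w - P w from rfl, hQw, hPw, sub_zero]
    have h2 : ‖w‖ ≤ ‖Q - P‖ * ‖w‖ := by
      conv_lhs => rw [h1]
      exact (Q - P).le_opNorm w
    have h3 : ‖Q - P‖ < 1 := by rwa [← neg_sub, norm_neg]
    nlinarith
  exact hv c (by rw [← hw0])

end Step

/-! ### The normal projection field of an immersed disc and the transported frame -/

section Transport

variable {F : Type*} [NormedAddCommGroup F] [InnerProductSpace ℝ F]

/-- The **normal projection field** `x ↦ normProj (Dg(x))` of a map `g : ℝ² → F`. [folklore] -/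
def normProjField (g : 𝔼 2 → F) (x : 𝔼 2) : F →L[ℝ] F := normProj (fderiv ℝ g x)

/-- Unfolding of the normal projection field. [folklore] -/
theorem normProjField_apply (g : 𝔼 2 → F) (x : 𝔼 2) : normProjField g x = normProj (fderiv ℝ g x) := rfl

/-- **The normal projection field of a `C^∞` map is `C^∞` at every immersive point.** [folklore] -/
theorem contDiffAt_normProjField {g : 𝔼 2 → F} (hg : ContDiff ℝ ∞ g) {x : 𝔼 2}
    (hx : Injective (fderiv ℝ g x)) : ContDiffAt ℝ ∞ (normProjField g) x :=
  (contDiffAt_normProj hx).comp x ((hg.fderiv_right (m := ∞) (by simp)).contDiffAt)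

/-- The set of immersive points of a `C^∞` map is open. [folklore] -/
theorem isOpen_setOf_injective_fderiv {g : 𝔼 2 → F} (hg : ContDiff ℝ ∞ g) :
    IsOpen {x : 𝔼 2 | Injective (fderiv ℝ g x)} := by
  have hc : Continuous fun x : 𝔼 2 ↦
      (![fderiv ℝ g x (EuclideanSpace.single 0 1), fderiv ℝ g x (EuclideanSpace.single 1 1)] :
        Fin 2 → F) := by
    have hd : Continuous (fderiv ℝ g) := (hg.continuous_fderiv (by simp))
    refine continuous_pi fun i ↦ ?_
    fin_cases i
    · exact (hd.clm_apply continuous_const)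
    · exact (hd.clm_apply continuous_const)
  have key : ∀ x : 𝔼 2, Injective (fderiv ℝ g x) ↔ LinearIndependent ℝ
      (![fderiv ℝ g x (EuclideanSpace.single 0 1), fderiv ℝ g x (EuclideanSpace.single 1 1)] :
        Fin 2 → F) := by
    intro x
    rw [Fintype.linearIndependent_iff]
    constructor
    · intro h c hc
      rw [Fin.sum_univ_two] at hc
      simp only [Matrix.cons_val_zero, Matrix.cons_val_one] at hc
      have h0 : fderiv ℝ g x (!₂[c 0, c 1]) = 0 := by
        rw [euclideanSpace_two_eq (!₂[c 0, c 1]), map_add, map_smul, map_smul]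
        simpa using hc
      have h1 := (injective_iff_map_eq_zero _).1 h _ h0
      intro i
      fin_cases i
      · simpa using congrArg (fun a : 𝔼 2 ↦ a 0) h1
      · simpa using congrArg (fun a : 𝔼 2 ↦ a 1) h1
    · intro h
      refine (injective_iff_map_eq_zero _).2 fun v hv ↦ ?_
      have key := h ![v 0, v 1] (by
        rw [Fin.sum_univ_two]
        simp only [Matrix.cons_val_zero, Matrix.cons_val_one]
        rw [euclideanSpace_two_eq v, map_add, map_smul, map_smul] at hv
        exact hv)
      have k0 : v 0 = 0 := by simpa using key 0
      have k1 : v 1 = 0 := by simpa using key 1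
      ext i; fin_cases i <;> simp [k0, k1]
  have : {x : 𝔼 2 | Injective (fderiv ℝ g x)} = (fun x : 𝔼 2 ↦
      (![fderiv ℝ g x (EuclideanSpace.single 0 1), fderiv ℝ g x (EuclideanSpace.single 1 1)] :
        Fin 2 → F)) ⁻¹' {f | LinearIndependent ℝ f} := by
    ext x; exact key x
  rw [this]
  exact isOpen_setOf_linearIndependent.preimage hc

/-- **A compact ball of immersive points thickens to an open ball of immersive points.** [folklore] -/
theorem exists_ball_injective_fderiv {g : 𝔼 2 → F} (hg : ContDiff ℝ ∞ g) {R : ℝ} (hR : 0 < R)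
    (hinj : ∀ x ∈ closedBall (0 : 𝔼 2) R, Injective (fderiv ℝ g x)) :
    ∃ R₁ : ℝ, R < R₁ ∧ ∀ x ∈ ball (0 : 𝔼 2) R₁, Injective (fderiv ℝ g x) := by
  obtain ⟨δ, hδ, hsub⟩ := (isCompact_closedBall (0 : 𝔼 2) R).exists_thickening_subset_open
    (isOpen_setOf_injective_fderiv hg) hinj
  refine ⟨R + δ, by linarith, fun x hx ↦ hsub ?_⟩
  rw [thickening_closedBall hδ hR.le, add_comm]
  exact hx

/-- **The transport of a vector along the ray `t ↦ t z` in `N` projection steps**: starting from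
`v`, apply successively the normal projections at `(1/N) z, (2/N) z, …, (k/N) z`. [folklore] -/
def rayTransport (g : 𝔼 2 → F) (N : ℕ) (v : F) : ℕ → 𝔼 2 → F
  | 0 => fun _ ↦ v
  | k + 1 => fun z ↦ normProjField g ((((k + 1 : ℕ) : ℝ) / N) • z) (rayTransport g N v k z)

/-- The transport after `0` steps is the initial vector. [folklore] -/
@[simp] theorem rayTransport_zero (g : 𝔼 2 → F) (N : ℕ) (v : F) (z : 𝔼 2) :
    rayTransport g N v 0 z = v := rfl

/-- The recursion of the transport. [folklore] -/
theorem rayTransport_succ (g : 𝔼 2 → F) (N : ℕ) (v : F) (k : ℕ) (z : 𝔼 2) :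
    rayTransport g N v (k + 1) z =
      normProjField g ((((k + 1 : ℕ) : ℝ) / N) • z) (rayTransport g N v k z) := rfl

/-- The transport is linear in the initial vector: negation. [folklore] -/
theorem rayTransport_neg (g : 𝔼 2 → F) (N : ℕ) (v : F) (k : ℕ) (z : 𝔼 2) :
    rayTransport g N (-v) k z = -rayTransport g N v k z := by
  induction k with
  | zero => rfl
  | succ k ih => rw [rayTransport_succ, rayTransport_succ, ih, map_neg]

/-- A sample point `(j/N) z`, `j ≤ N`, of a point of the ball of radius `R₁` lies in that ball.
[folklore] -/
theorem smul_mem_ball_of_le {N j : ℕ} (hN : 0 < N) (hj : j ≤ N) {R₁ : ℝ} {z : 𝔼 2}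
    (hz : z ∈ ball (0 : 𝔼 2) R₁) : (((j : ℝ) / N) • z) ∈ ball (0 : 𝔼 2) R₁ := by
  rw [mem_ball_zero_iff] at hz ⊢
  have hc0 : 0 ≤ (j : ℝ) / N := by positivity
  have hc1 : (j : ℝ) / N ≤ 1 := by
    rw [div_le_one (by exact_mod_cast hN)]
    exact_mod_cast hj
  rw [norm_smul, Real.norm_of_nonneg hc0]
  calc (j : ℝ) / N * ‖z‖ ≤ 1 * ‖z‖ := by gcongr
    _ = ‖z‖ := one_mul _
    _ < R₁ := hz

/-- The same for the closed ball. [folklore] -/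
theorem smul_mem_closedBall_of_le {N j : ℕ} (hN : 0 < N) (hj : j ≤ N) {R₁ : ℝ} {z : 𝔼 2}
    (hz : z ∈ closedBall (0 : 𝔼 2) R₁) : (((j : ℝ) / N) • z) ∈ closedBall (0 : 𝔼 2) R₁ := by
  rw [mem_closedBall_zero_iff] at hz ⊢
  have hc0 : 0 ≤ (j : ℝ) / N := by positivity
  have hc1 : (j : ℝ) / N ≤ 1 := by
    rw [div_le_one (by exact_mod_cast hN)]
    exact_mod_cast hj
  rw [norm_smul, Real.norm_of_nonneg hc0]
  calc (j : ℝ) / N * ‖z‖ ≤ 1 * ‖z‖ := by gcongr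
    _ = ‖z‖ := one_mul _
    _ ≤ R₁ := hz

/-- **The transport is `C^∞`** on an open ball of immersive points containing all its sample points.
[folklore] -/
theorem contDiffOn_rayTransport {g : 𝔼 2 → F} (hg : ContDiff ℝ ∞ g) {R₁ : ℝ}
    (hinj : ∀ x ∈ ball (0 : 𝔼 2) R₁, Injective (fderiv ℝ g x)) {N : ℕ} (hN : 0 < N) (v : F) :
    ∀ k ≤ N, ContDiffOn ℝ ∞ (rayTransport g N v k) (ball (0 : 𝔼 2) R₁) := by
  intro k
  induction k with
  | zero => exact fun _ ↦ contDiffOn_const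
  | succ k ih =>
    intro hk z hz
    have hk' : k ≤ N := (Nat.le_succ k).trans hk
    have hsample : (((k + 1 : ℕ) : ℝ) / N) • z ∈ ball (0 : 𝔼 2) R₁ := smul_mem_ball_of_le hN hk hz
    have hP : ContDiffAt ℝ ∞ (fun y : 𝔼 2 ↦ normProjField g ((((k + 1 : ℕ) : ℝ) / N) • y)) z :=
      (contDiffAt_normProjField hg (hinj _ hsample)).comp z (contDiffAt_id.const_smul _)
    exact (hP.contDiffWithinAt.clm_apply (ih hk' z hz)).congr (fun y _ ↦ rayTransport_succ g N v k y)
      (rayTransport_succ g N v k z)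

/-- **The transported frame stays a frame of the normal spaces.** If `x ↦ normProj (Dg x)` varies by
less than `1` in operator norm between consecutive sample points (`‖z‖ / N < δ` with `δ` a modulus of
uniform continuity on a ball containing them), then after `k ≤ N` steps the transports of a basis of
the normal space at `0` form a basis of the normal space at `(k/N) z`. [folklore] -/
theorem linearIndependent_rayTransport {g : 𝔼 2 → F} {R' : ℝ}
    (hinj : ∀ x ∈ closedBall (0 : 𝔼 2) R', Injective (fderiv ℝ g x)) {δ : ℝ}
    (hδ : ∀ x ∈ closedBall (0 : 𝔼 2) R', ∀ y ∈ closedBall (0 : 𝔼 2) R', dist x y < δ →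
      ‖normProjField g x - normProjField g y‖ < 1)
    {N : ℕ} (hN : 0 < N) (hNδ : R' / N < δ) {b : Fin 2 → F} (hb : LinearIndependent ℝ b)
    (hb0 : ∀ i, normProjField g 0 (b i) = b i) {z : 𝔼 2} (hz : z ∈ closedBall (0 : 𝔼 2) R') :
    ∀ k ≤ N, LinearIndependent ℝ (fun i ↦ rayTransport g N (b i) k z) ∧
      ∀ i, normProjField g ((((k : ℕ) : ℝ) / N) • z) (rayTransport g N (b i) k z) =
        rayTransport g N (b i) k z := by
  intro k
  induction k with
  | zero =>
    intro _
    refine ⟨by simpa using hb, fun i ↦ ?_⟩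
    simp [hb0 i]
  | succ k ih =>
    intro hk
    have hk' : k ≤ N := (Nat.le_succ k).trans hk
    obtain ⟨hli, hfix⟩ := ih hk'
    set x₀ : 𝔼 2 := (((k : ℕ) : ℝ) / N) • z with hx₀
    set x₁ : 𝔼 2 := (((k + 1 : ℕ) : ℝ) / N) • z with hx₁
    have hx₀m : x₀ ∈ closedBall (0 : 𝔼 2) R' := smul_mem_closedBall_of_le hN hk' hz
    have hx₁m : x₁ ∈ closedBall (0 : 𝔼 2) R' := smul_mem_closedBall_of_le hN hk hz
    -- consecutive sample points are `‖z‖ / N < δ` apart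
    have hdist : dist x₁ x₀ < δ := by
      rw [dist_eq_norm, hx₁, hx₀, ← sub_smul, norm_smul]
      have : (((k + 1 : ℕ) : ℝ) / N - ((k : ℕ) : ℝ) / N) = 1 / N := by
        push_cast; ring
      rw [this, Real.norm_of_nonneg (by positivity)]
      rw [mem_closedBall_zero_iff] at hz
      calc 1 / (N : ℝ) * ‖z‖ = ‖z‖ / N := by ring
        _ ≤ R' / N := by gcongr
        _ < δ := hNδ
    have hstep := hδ x₁ hx₁m x₀ hx₀m hdist
    refine ⟨?_, fun i ↦ ?_⟩
    · have := linearIndependent_map_of_opNorm_sub_lt hstep hfix hli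
      simpa only [rayTransport_succ] using this
    · rw [rayTransport_succ, ← hx₁, normProjField_apply]
      exact normProj_normProj (hinj x₁ hx₁m) _

variable [FiniteDimensional ℝ F]

/-- **The normal space of an immersion `ℝ² → F` at a point has a basis of two vectors** when
`dim F = 4`. [folklore] -/
theorem exists_linearIndependent_normProj_eq {L : 𝔼 2 →L[ℝ] F} (hL : Injective L)
    (hF : Module.finrank ℝ F = 4) :
    ∃ b : Fin 2 → F, LinearIndependent ℝ b ∧ ∀ i, normProj L (b i) = b i := by
  have h1 : Module.finrank ℝ (LinearMap.range (L : 𝔼 2 →ₗ[ℝ] F)) = 2 := by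
    have h := LinearMap.finrank_range_of_inj (f := (L : 𝔼 2 →ₗ[ℝ] F)) hL
    rw [h, finrank_euclideanSpace_fin]
  have h2 : Module.finrank ℝ (LinearMap.range (L : 𝔼 2 →ₗ[ℝ] F))ᗮ = 2 := by
    have := Submodule.finrank_add_finrank_orthogonal (LinearMap.range (L : 𝔼 2 →ₗ[ℝ] F))
    rw [h1, hF] at this
    omega
  let bW : Module.Basis (Fin 2) ℝ (LinearMap.range (L : 𝔼 2 →ₗ[ℝ] F))ᗮ :=
    Module.finBasisOfFinrankEq ℝ _ h2
  refine ⟨fun i ↦ (bW i : F), ?_, fun i ↦ ?_⟩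
  · exact bW.linearIndependent.map' (LinearMap.range (L : 𝔼 2 →ₗ[ℝ] F))ᗮ.subtype (Submodule.ker_subtype _)
  · rw [normProj_eq_self_iff hL]
    intro a
    exact (Submodule.mem_orthogonal _ _).1 (bW i).2 (L a) ⟨a, rfl⟩

/-- **A global `C^∞` frame of the normal bundle of an immersed disc.** Let `g : ℝ² → F` be `C^∞` into a
`4`-dimensional real inner product space, with injective differential on the closed ball `B̄(0, R)`.
Then on some larger open ball `B(0, R')` (still consisting of immersive points) there are `C^∞`
vector fields `n₀, n₁` along `g` which at every point are fixed by the normal projection (i.e. lie in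
`(range Dg(x))ᗮ`) and are linearly independent — a trivialisation of the normal bundle of the disc
(Hirsch (1976), Ch. 4 §2, Cor. 2.5), by transport along the rays from the centre. [cite: Hirsch1976, Ch. 4 §2 Cor. 2.5] -/
theorem exists_normalFrame {g : 𝔼 2 → F} (hg : ContDiff ℝ ∞ g) (hF : Module.finrank ℝ F = 4)
    {R : ℝ} (hR : 0 < R) (hinj : ∀ x ∈ closedBall (0 : 𝔼 2) R, Injective (fderiv ℝ g x)) :
    ∃ (R' : ℝ) (n : Fin 2 → 𝔼 2 → F), R < R' ∧
      (∀ x ∈ ball (0 : 𝔼 2) R', Injective (fderiv ℝ g x)) ∧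
      (∀ i, ContDiffOn ℝ ∞ (n i) (ball (0 : 𝔼 2) R')) ∧
      (∀ x ∈ ball (0 : 𝔼 2) R', ∀ i, normProjField g x (n i x) = n i x) ∧
      (∀ x ∈ ball (0 : 𝔼 2) R', LinearIndependent ℝ (fun i ↦ n i x)) := by
  -- an open ball of immersive points
  obtain ⟨R₁, hRR₁, hinj₁⟩ := exists_ball_injective_fderiv hg hR hinj
  set R' : ℝ := (R + R₁) / 2 with hR'def
  have hRR' : R < R' := by rw [hR'def]; linarith
  have hR'R₁ : R' < R₁ := by rw [hR'def]; linarith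
  have hsub : closedBall (0 : 𝔼 2) R' ⊆ ball (0 : 𝔼 2) R₁ := closedBall_subset_ball hR'R₁
  have hinj' : ∀ x ∈ closedBall (0 : 𝔼 2) R', Injective (fderiv ℝ g x) := fun x hx ↦ hinj₁ x (hsub hx)
  -- uniform continuity of the projection field on the compact ball
  have hcont : ContinuousOn (normProjField g) (closedBall (0 : 𝔼 2) R') := fun x hx ↦
    (contDiffAt_normProjField hg (hinj' x hx)).continuousAt.continuousWithinAt
  obtain ⟨δ, hδ, hδP⟩ := Metric.uniformContinuousOn_iff.1
    ((isCompact_closedBall (0 : 𝔼 2) R').uniformContinuousOn_of_continuous hcont) 1 one_pos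
  have hδP' : ∀ x ∈ closedBall (0 : 𝔼 2) R', ∀ y ∈ closedBall (0 : 𝔼 2) R', dist x y < δ →
      ‖normProjField g x - normProjField g y‖ < 1 := fun x hx y hy hxy ↦ by
    rw [← dist_eq_norm]; exact hδP x hx y hy hxy
  -- the number of steps
  obtain ⟨N, hN⟩ := exists_nat_gt (R' / δ)
  have hR'0 : 0 ≤ R' := by linarith
  have hN0 : 0 < N := by
    have : (0 : ℝ) < N := lt_of_le_of_lt (div_nonneg hR'0 hδ.le) hN
    exact_mod_cast this
  have hNδ : R' / N < δ := by
    rw [div_lt_iff₀ (by exact_mod_cast hN0)]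
    rw [div_lt_iff₀ hδ] at hN
    linarith [mul_comm δ (N : ℝ)]
  -- a basis of the normal space at the centre
  obtain ⟨b, hb, hb0⟩ := exists_linearIndependent_normProj_eq (hinj 0 (by simp [hR.le])) hF
  refine ⟨R', fun i z ↦ rayTransport g N (b i) N z, hRR', fun x hx ↦ hinj' x (ball_subset_closedBall hx),
    fun i ↦ (contDiffOn_rayTransport hg hinj₁ hN0 (b i) N le_rfl).mono (ball_subset_closedBall.trans hsub),
    fun x hx ↦ ?_, fun x hx ↦ ?_⟩
  · intro i
    have h := (linearIndependent_rayTransport hinj' hδP' hN0 hNδ hb hb0 (ball_subset_closedBall hx)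
      N le_rfl).2 i
    rwa [div_self (by exact_mod_cast hN0.ne'), one_smul] at h
  · exact (linearIndependent_rayTransport hinj' hδP' hN0 hNδ hb hb0 (ball_subset_closedBall hx)
      N le_rfl).1

end Transport

end Literature.Topology.FourManifolds
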